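import Mathlib
import HarnessLib
import Literature.MathematicalPhysics.QuantumLattice.KohnLuttinger
import Summits.HubbardSuperconductivity.HubbardSuperconductivity.Theorems.ChiralWindowCwKLChiralWindowWindowBridge
import Summits.HubbardSuperconductivity.HubbardSuperconductivity.Theorems.ChiralWindowCwKLChiralWindowReductionL2
import Summits.HubbardSuperconductivity.HubbardSuperconductivity.Theorems.ChiralWindowCwKLChiralWindowMeanZero
import Summits.HubbardSuperconductivity.HubbardSuperconductivity.Theorems.ChiralWindowCwKLChiralWindowD4Invariant
import Summits.HubbardSuperconductivity.HubbardSuperconductivity.Theorems.ChiralWindowCwKLChiralWindowFiniteMeasure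
import Summits.HubbardSuperconductivity.HubbardSuperconductivity.Theorems.ChiralWindowCwKLChiralWindowGradient
import Summits.HubbardSuperconductivity.HubbardSuperconductivity.Theorems.ChiralWindowCwKLChiralWindowHausdorffFinite

/-!
# `TwTipContinuation` (stmt-HubbardSuperconductivity-1700) — line `kl-mechanism-datum`,
# stub `stub_b1gPointReduction` (the point reduction of the Kohn–Luttinger `B₁g`-leadership datum)

Write `ε₀ = squareDispersion 1 0`, `n = KohnLuttinger.filling ε₀` (free-band filling),
`μ(m) = chemicalPotentialOfDensity ε₀ m` and `Λ_U(μ, χ) = channelInf ε₀ μ U χ` (bottom of the pairing form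
with kernel `U + U² χ₀(k+k')` in the `D₄` channel `χ`).

If at a band level `μ₀ ∈ (-4, 0)` with `n(μ₀) ∈ [3/5, 9/10]` the `U = 1` bottoms satisfy
`Λ_1(μ₀, B1g) + γ ≤ Λ_1(μ₀, χ)` for every `χ ≠ B1g` (`γ > 0`), then the in-window datum holds at
`δ := 1 - n(μ₀) ∈ [1/10, 2/5]` with `U₁ = 1` and margin `γ U²`:

* `μ(1 - δ) = μ₀` (`kl_wb_chemicalPotential_one_sub_one_sub`);
* for `χ ≠ A1g` every channel state has vanishing mean on the finite, `D₄`-invariant Fermi-curve measure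
  (`stub_klMeanZero`, `stub_klFiniteMeasure`, `stub_klD4Invariant`, `stub_klGradient`, `stub_klHausdorffFinite`),
  so `Λ_U(μ₀, χ) = U² Λ_1(μ₀, χ)` (`kl_rl_channelInf_sq_of_meanZero`);
* for every `χ` and `0 < U ≤ 1`, `U² Λ_1(μ₀, χ) ≤ Λ_U(μ₀, χ)` (bare-`U` penalty, `kl_rl_sq_channelInf_one_le`).

Hence `Λ_U(B1g) + γU² = U²(Λ_1(B1g) + γ) ≤ U² Λ_1(χ) ≤ Λ_U(χ)`; this is clause (i) of
`cwKLChiralWindow_of_certificate` / `stub_klReductionL2` at a single level.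

Reference: S. Raghu, S. A. Kivelson, D. J. Scalapino, Phys. Rev. B 81 (2010) 224505, §II (7), (13).
-/

noncomputable section

namespace Summit.HubbardSuperconductivity.TwTipContinuation.KlMechanismDatum

open MeasureTheory Literature.MathematicalPhysics.QuantumLattice
open Summit.HubbardSuperconductivity.HubbardSuperconductivity.Theorems

/-- **(R) Point reduction.**  `U = 1` leadership of `B₁g` by `γ > 0` at a level `μ₀ ∈ (-4,0)` whose free-band
filling lies in `[3/5, 9/10]` gives the in-window datum: `δ := 1 - n(μ₀) ∈ [1/10, 2/5]`, `μ(1-δ) = μ₀`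
(`kl_wb_chemicalPotential_one_sub_one_sub`), and for `U ∈ (0,1)` the bottoms scale as `U²` off `A1g`
(`kl_rl_channelInf_sq_of_meanZero`, mean zero by `stub_klMeanZero`) while `U² Λ₁(χ) ≤ Λ_U(χ)` for every channel
(`kl_rl_sq_channelInf_one_le`); cf. clause (i) of `cwKLChiralWindow_of_certificate`.
[cite: RaghuKivelsonScalapino2010, §II (7) and (13)] -/
theorem stub_b1gPointReduction :
    ∀ μ₀ γ : ℝ, -4 < μ₀ → μ₀ < 0 → 0 < γ →
    3 / 5 ≤ KohnLuttinger.filling (squareDispersion 1 0) μ₀ →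
    KohnLuttinger.filling (squareDispersion 1 0) μ₀ ≤ 9 / 10 →
    (∀ χ : D4Irrep, χ ≠ D4Irrep.B1g →
      channelInf (squareDispersion 1 0) μ₀ 1 D4Irrep.B1g + γ ≤ channelInf (squareDispersion 1 0) μ₀ 1 χ) →
    ∃ δ ∈ Set.Icc (1 / 10 : ℝ) (2 / 5), ∃ γ U₁ : ℝ, 0 < γ ∧ 0 < U₁ ∧ ∀ U ∈ Set.Ioo (0:ℝ) U₁,
      ∀ χ : D4Irrep, χ ≠ D4Irrep.B1g →
        channelInf (squareDispersion 1 0) (chemicalPotentialOfDensity (squareDispersion 1 0) (1 - δ)) U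
            D4Irrep.B1g + γ * U ^ 2 ≤
          channelInf (squareDispersion 1 0) (chemicalPotentialOfDensity (squareDispersion 1 0) (1 - δ)) U χ := by
  intro μ₀ γ h4 h0 hγ hlo hhi hlead
  refine ⟨1 - KohnLuttinger.filling (squareDispersion 1 0) μ₀, ⟨by linarith, by linarith⟩, γ, 1, hγ,
    one_pos, ?_⟩
  intro U hU χ hχ
  -- the level realising the density `1 - δ = n(μ₀)` is `μ₀` itself
  have hμ : chemicalPotentialOfDensity (squareDispersion 1 0)
      (1 - (1 - KohnLuttinger.filling (squareDispersion 1 0) μ₀)) = μ₀ :=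
    kl_wb_chemicalPotential_one_sub_one_sub h4 (by linarith)
  rw [hμ]
  -- the Fermi-curve measure at `μ₀` is finite and `D₄`-invariant, so non-trivial channels have mean zero
  have hfin : IsFiniteMeasure (fermiCurveMeasure (squareDispersion 1 0) μ₀) :=
    stub_klFiniteMeasure stub_klGradient stub_klHausdorffFinite μ₀ ⟨h4, h0⟩
  have hinv : ∀ g : DihedralGroup 4, MeasurePreserving (d4Momentum g)
      (fermiCurveMeasure (squareDispersion 1 0) μ₀) (fermiCurveMeasure (squareDispersion 1 0) μ₀) :=
    stub_klD4Invariant stub_klGradient μ₀ ⟨h4, h0⟩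
  -- `U²`-homogeneity of the `B1g` bottom (`B1g ≠ A1g`)
  have hhom : channelInf (squareDispersion 1 0) μ₀ U D4Irrep.B1g =
      U ^ 2 * channelInf (squareDispersion 1 0) μ₀ 1 D4Irrep.B1g :=
    kl_rl_channelInf_sq_of_meanZero h4 h0 U D4Irrep.B1g
      (fun ψ hψ => (stub_klMeanZero _ _ hfin hinv D4Irrep.B1g ψ (by decide) hψ).2)
  -- bare-`U` penalty in the competing channel (any `χ`, `0 < U ≤ 1`)
  have hpen : U ^ 2 * channelInf (squareDispersion 1 0) μ₀ 1 χ ≤ channelInf (squareDispersion 1 0) μ₀ U χ :=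
    kl_rl_sq_channelInf_one_le h4 h0 hU.1 hU.2.le χ
  rw [hhom]
  have h1 := mul_le_mul_of_nonneg_left (hlead χ hχ) (sq_nonneg U)
  nlinarith

end Summit.HubbardSuperconductivity.TwTipContinuation.KlMechanismDatum

end
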